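import Summits.AtomisticToContinuum.FouriersLaw.Theorems.EmbeddedDrudeMourreAbelThermodynamicLimitOfLowerBound
import Summits.AtomisticToContinuum.FouriersLaw.Theorems.EmbeddedDrudeMourreAbelThermodynamicLimitRegularityIffCommonLimit
import Summits.AtomisticToContinuum.FouriersLaw.Theorems.EmbeddedDrudeMourreNessUnique
import HarnessLib

/-!
# REDIRECT r1 (crux-strategist) — is `StaticAbelianSqueeze.UniformAbelianRegularity` (stmt-13416) the summit in costume?

Kernel record for the STRATEGY-CENSUS of the redirect strategist r1 (2026-08-17).  Over LANDED theorems only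
(`exists_regularPair_commonLimit_of_regularity`, `exists_steadyFamily_response` — p127832/p132484 family —,
`nessUnique_proof`, `finiteResponse_of_unique`, `pinnedChain_exists_isSteadyState`):

* `ConvergenceHalf` := clause (ii) of `FouriersLawFor (pinnedChain …)` with the positivity of `κ` deleted
  (the thermodynamic-limit half of the summit conjunct; clause (i) is proved in tree).
* `convergenceHalf_of_uniformAbelianRegularity : (R) → ConvergenceHalf`            — (R) carries the WHOLE convergence half.
* `conductanceLowerBound_of_fouriersLaw : FouriersLaw → CLB`                        — the positivity crux is summit-necessary.
* `fouriersLaw_iff_convergenceHalf_and_clb : FouriersLaw ↔ ConvergenceHalf ∧ CLB`   — the summit conjunct is exactly these two halves.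
* `fouriersLaw_of_uniformAbelianRegularity_of_clb : (R) → CLB → FouriersLaw`        — the route's `closes` needs NONE of
  `ResolventSqueeze` (S), `LiouvilleNoGap` (G), `ShiftInvariantGibbsState` (Γ), `KuboAbelIdentity` (K),
  `FiniteResponseOfUnique`, `NessUnique` as hypotheses: `assembly_ignoring_the_squeeze` proves the route's `Assembly`
  by a function that discards them.

Conclusion recorded in STRATEGY-CENSUS.md: (R) ≥ (FouriersLaw minus its positivity conjunct CLB); with the landed
`stub_regularityIffCommonLimit` (p132484) (R) = ConvergenceHalf ∧ [Abel–Green–Kubo identification with a regular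
infinite-volume pair]; no converse `ConvergenceHalf → (R)` and no separating witness is known.
-/

noncomputable section

open MeasureTheory Filter Set
open scoped Topology

namespace Summit.AtomisticToContinuum.FouriersLaw.Cruxes.UniformAbelianRegularity.RedirectR1

open Literature.MathematicalPhysics.KineticTheory.HeatConduction
open Summit.AtomisticToContinuum.FouriersLaw.Theses

/-- The CONVERGENCE HALF of the summit conjunct: clause (ii) of
`OscillatorChain.FouriersLawFor (pinnedChain ω₂ lam β γ)` for all parameters `> 0`, with `∀ T > 0, 0 < κ T` deleted. -/
def ConvergenceHalf : Prop :=
  ∀ ω₂ lam β γ : ℝ, 0 < ω₂ → 0 < lam → 0 < β → 0 < γ →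
    ∃ κ : ℝ → ℝ,
      ∀ μ : (N : ℕ) → ℝ → ℝ → Measure (PhaseSpace N),
        (∀ (N : ℕ) (T_L T_R : ℝ), 0 < T_L → 0 < T_R →
          (pinnedChain ω₂ lam β γ).IsSteadyState N T_L T_R (μ N T_L T_R)) →
        ∀ T : ℝ, 0 < T →
          ∃ D : ℕ → ℝ,
            (∀ N : ℕ, Tendsto (fun δ : ℝ =>
                (pinnedChain ω₂ lam β γ).totalCurrent (μ N (T + δ / 2) (T - δ / 2)) / δ)
              (𝓝[≠] 0) (𝓝 (D N))) ∧
            Tendsto D atTop (𝓝 (κ T))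

/-- **(R) ⇒ the whole convergence half of the summit conjunct.** [cite: BonettoLebowitzReyBellet2000, §5.3 eq. (33)] -/
theorem convergenceHalf_of_uniformAbelianRegularity
    (hR : StaticAbelianSqueeze.UniformAbelianRegularity) : ConvergenceHalf := by
  classical
  intro ω₂ lam β γ hω hl hβ hγ
  have hU := Summit.AtomisticToContinuum.FouriersLaw.Theorems.nessUnique_proof ω₂ lam β γ hω hl hβ hγ
  have key : ∀ T : ℝ, 0 < T → ∃ L : ℝ,
      ∀ (μ : (N : ℕ) → ℝ → ℝ → Measure (PhaseSpace N)) (Dn : ℕ → ℝ),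
        (∀ (N : ℕ) (T_L T_R : ℝ), 0 < T_L → 0 < T_R →
          (pinnedChain ω₂ lam β γ).IsSteadyState N T_L T_R (μ N T_L T_R)) →
        (∀ N : ℕ, Tendsto (fun δ : ℝ =>
            (pinnedChain ω₂ lam β γ).totalCurrent (μ N (T + δ / 2) (T - δ / 2)) / δ)
          (𝓝[≠] 0) (𝓝 (Dn N))) →
        Tendsto Dn atTop (𝓝 L) := by
    intro T hT
    obtain ⟨μT, D, L, -, -, -, -, -, -, -, hKubo⟩ :=
      Summit.AtomisticToContinuum.FouriersLaw.Theorems.AbelThermodynamicLimit.LoomisCompactHorizonWitness.exists_regularPair_commonLimit_of_regularity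
        hR ω₂ lam β γ hω hl hβ hγ hU T hT
    have hT2 : 0 < T ^ 2 := pow_pos hT 2
    refine ⟨(T ^ 2)⁻¹ * L, fun μ Dn hμ hDn => ?_⟩
    have := (hKubo μ Dn hμ hDn).const_mul ((T ^ 2)⁻¹)
    simpa [← mul_assoc, inv_mul_cancel₀ hT2.ne'] using this
  choose Lf hLf using key
  refine ⟨fun T => if h : 0 < T then Lf T h else 0, fun μ hμ T hT => ?_⟩
  have hD := Summit.AtomisticToContinuum.FouriersLaw.Theorems.FourierGreenKubo.finiteResponse_of_unique
    ω₂ lam β γ hω hl hβ hγ hU μ hμ T hT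
  choose Dn hDn using hD
  refine ⟨Dn, hDn, ?_⟩
  simp only [dif_pos hT]
  exact hLf T hT μ Dn hμ hDn

/-- **The positivity crux is summit-necessary**: `FouriersLaw → ConductanceLowerBound` (trivial: `D_N → κ(T) > 0`). [folklore] -/
theorem conductanceLowerBound_of_fouriersLaw (hF : _root_.FouriersLaw) :
    StaticAbelianSqueeze.ConductanceLowerBound := by
  intro ω₂ lam β γ hω hl hβ hγ _hU μ hμ T hT D hD
  obtain ⟨-, κ, hκpos, hfam⟩ := hF ω₂ lam β γ hω hl hβ hγ
  obtain ⟨D', hD', hlim⟩ := hfam μ hμ T hT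
  have hDD : ∀ N, D N = D' N := fun N => tendsto_nhds_unique (hD N) (hD' N)
  have hlimD : Tendsto D atTop (𝓝 (κ T)) := by
    have : D = D' := funext hDD
    rw [this]; exact hlim
  have hκ := hκpos T hT
  have hev : ∀ᶠ N in atTop, κ T / 2 ≤ D N :=
    hlimD.eventually_const_le (by linarith)
  obtain ⟨N₁, hN₁⟩ := eventually_atTop.1 hev
  exact ⟨κ T / 2, by linarith, N₁, fun N hN => hN₁ N hN⟩

/-- **The two halves give the summit conjunct** (clause (i) is proved in tree). [cite: CuneoEckmannHairerReyBellet2018, Thm 2.13] -/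
theorem fouriersLaw_of_convergenceHalf_of_clb (hC : ConvergenceHalf)
    (hP : StaticAbelianSqueeze.ConductanceLowerBound) : _root_.FouriersLaw := by
  classical
  intro ω₂ lam β γ hω hl hβ hγ
  have hU := Summit.AtomisticToContinuum.FouriersLaw.Theorems.nessUnique_proof ω₂ lam β γ hω hl hβ hγ
  refine ⟨fun N T_L T_R hL hRt => ?_, ?_⟩
  · obtain ⟨μ, hμ⟩ := pinnedChain_exists_isSteadyState hω hl hβ hγ N hL hRt
    exact ⟨μ, hμ, fun ν hν => hU N T_L T_R hL hRt ν μ hν hμ⟩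
  obtain ⟨κ, hκ⟩ := hC ω₂ lam β γ hω hl hβ hγ
  refine ⟨κ, fun T hT => ?_, hκ⟩
  obtain ⟨μc, Dc, hμc, hDc⟩ :=
    Summit.AtomisticToContinuum.FouriersLaw.Theorems.AbelThermodynamicLimit.LoomisCompactHorizonWitness.exists_steadyFamily_response
      ω₂ lam β γ hω hl hβ hγ hU T hT
  obtain ⟨D, hD, hlim⟩ := hκ μc hμc T hT
  obtain ⟨c, hc, N₁, hN₁⟩ := hP ω₂ lam β γ hω hl hβ hγ hU μc hμc T hT D hD
  have : c ≤ κ T := ge_of_tendsto hlim (eventually_atTop.2 ⟨N₁, hN₁⟩)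
  exact lt_of_lt_of_le hc this

/-- **The summit conjunct is exactly ConvergenceHalf ∧ CLB** over landed theorems. [cite: BonettoLebowitzReyBellet2000, §5.3 eq. (33)] -/
theorem fouriersLaw_iff_convergenceHalf_and_clb :
    _root_.FouriersLaw ↔ ConvergenceHalf ∧ StaticAbelianSqueeze.ConductanceLowerBound := by
  refine ⟨fun hF => ⟨?_, conductanceLowerBound_of_fouriersLaw hF⟩,
    fun h => fouriersLaw_of_convergenceHalf_of_clb h.1 h.2⟩
  intro ω₂ lam β γ hω hl hβ hγ
  obtain ⟨-, κ, -, hfam⟩ := hF ω₂ lam β γ hω hl hβ hγ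
  exact ⟨κ, hfam⟩

/-- **(R) ∧ CLB ⇒ FouriersLaw with nothing else**: the deciding theorem of route StaticAbelianSqueeze needs none of its
squeeze cruxes (S) `ResolventSqueeze`, (G) `LiouvilleNoGap`, (Γ) `ShiftInvariantGibbsState`.
[cite: BonettoLebowitzReyBellet2000, §5.3 eq. (33)] -/
theorem fouriersLaw_of_uniformAbelianRegularity_of_clb
    (hR : StaticAbelianSqueeze.UniformAbelianRegularity) (hP : StaticAbelianSqueeze.ConductanceLowerBound) :
    _root_.FouriersLaw :=
  fouriersLaw_of_convergenceHalf_of_clb (convergenceHalf_of_uniformAbelianRegularity hR) hP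

/-- The route's own `Assembly` item, proved by a function that DISCARDS `NessUnique`, `FiniteResponseOfUnique`,
`KuboAbelIdentity`, `ResolventSqueeze`, `LiouvilleNoGap`, `ShiftInvariantGibbsState`. [folklore] -/
theorem assembly_ignoring_the_squeeze : StaticAbelianSqueeze.Assembly :=
  fun _ _ _ _ _ hR hP _ => fouriersLaw_of_uniformAbelianRegularity_of_clb hR hP

/-- (R) restated BY NAME as the common-limit statement is the landed theorem
`…AbelThermodynamicLimit.LoomisCompactHorizonWitness.stub_regularityIffCommonLimit` (p132484); referenced here so the
import is load-bearing. [cite: KunduDharNarayan2009, eqs. (8)–(15)] -/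
example := @Summit.AtomisticToContinuum.FouriersLaw.Theorems.AbelThermodynamicLimit.LoomisCompactHorizonWitness.stub_regularityIffCommonLimit

end Summit.AtomisticToContinuum.FouriersLaw.Cruxes.UniformAbelianRegularity.RedirectR1

end
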